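import Summits.QuantumFields.QCD.Theorems.HeatSlicedQuarksSmallFieldUltracontractivityStubCommutatorBoundAux
import Summits.QuantumFields.QCD.Theorems.HeatSlicedQuarksSmallFieldUltracontractivityStubCommutatorBoundLocal
import Literature.Probability.LatticeModels.TorusFourierProofs

/-!
# Stub `stub_commutatorBound` of line `point-centred-axial-parabolic`
(crux `Summit.QuantumFields.QCD.Theses.HeatSlicedQuarks.SmallFieldUltracontractivity`, item stmt-QuantumFields-8871)

In the lead's cut-off Duhamel parametrix for `e^{-sH_U}` the spatial cutoff `M_χ` (product cutoff
`χ(z) = ∏_ν f(c_ν(z - x)/N)` of scale `N` centred at `x`) produces the commutator term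
`∫ row_x(K_{s-τ} [H₁, M_χ] e^{-τH_U}) dτ`, `K_σ = e^{-σH₁}`, `H₁ = D₁ᴴD₁` the free massive Wilson
operator.  This file proves the registered stub `stub_commutatorBound`: the parabolic decay of the
free kernel (hypothesis `FreeKernelDecay`, stub `stub_freeKernelDecay`) implies that the row of
`K_σ [H₁, M_χ]` at `(x, a, α)` has `ℓ²` norm `≤ C/N⁴`, uniformly in `σ ∈ [0, L²]`.

* `CommutatorBound.comm_entry_norm` — the `(i, j)` entry of `K [H, M_χ]` is, up to conjugation and
  sign, the commutator `[H, χ]` applied to the conjugated row `conj K(i, ·)`, evaluated at `j`;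
* `CommutatorBound.comm_entry_eq_zero` — by the range `2` of `H₁`
  (`conjTranspose_mul_wilsonDirac_apply_eq_zero`) and `χ = 1` / `0` on / off the balls of radius
  `N` / `2N`, the entry vanishes unless `N - 2 ≤ torusDist x j ≤ 2N + 2`;
* `CommutatorBound.card_ball_le` — at most `12 (2R+1)⁴` indices at torus distance `≤ R`;
* `CommutatorBound.row_sq_sum_le` — with the local commutator bound `stub_commutatorBoundLocal`
  (entries `≤ 2056 (A₂B₀ + A₁B₁)` on the annulus) the squared row norm is
  `≤ 12 (4N+5)⁴ (2056 (A₂B₀ + A₁B₁))²`;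
* `stub_commutatorBound` — the cutoff calculus `stub_commutatorBoundAux` (`A₁ = 8/N`,
  `A₂ = 72/N²`) and the kernel decay at distance `d ≥ N - 4 ≥ N/2` (`B₀ = 16C/N⁴`, `B₁ = 32C/N⁵`,
  from `(1+σ)/(1+σ+d²)³ ≤ d⁻⁴` and `√(1+σ)/(1+σ+d²)³ ≤ d⁻⁵`) give `(C'/N⁴)²` with
  `C' = 100·2056·1408·|C|`.
-/

noncomputable section

namespace Summit.QuantumFields.QCD.Cruxes.SmallFieldUltracontractivity.PointCentredAxialParabolic

open Literature.MathematicalPhysics.QuantumLattice Literature.MathematicalPhysics.QuantumFieldTheory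
open Literature.Probability.LatticeModels (TorusSite torusChar)
open Summit.QuantumFields.QCD.Theorems.SmallFieldUltracontractivity.Negative
open scoped Matrix ComplexConjugate

namespace CommutatorBound

open Summit.QuantumFields.QCD.Theorems.HeatSlicedQuarksDaviesGaffney

section RowSum

variable {L : ℕ} [NeZero L]

/-- **Entry identity.**  For Hermitian `H` and a real site function `χ`, the `(i, j)` entry of
`K [H, M_χ]` is, up to complex conjugation and sign, the commutator `[H, χ]` applied to the
conjugated row `u = conj K(i, ·)` and evaluated at `j`. -/
theorem comm_entry_norm
    (K H : Matrix (TorusSite 4 L × Fin 3 × Fin 4) (TorusSite 4 L × Fin 3 × Fin 4) ℂ)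
    (hH : H.IsHermitian) (χ : TorusSite 4 L → ℝ) (i j : TorusSite 4 L × Fin 3 × Fin 4) :
    ‖(K * (H * Matrix.diagonal (fun k : TorusSite 4 L × Fin 3 × Fin 4 => (χ k.1 : ℂ)) -
        Matrix.diagonal (fun k : TorusSite 4 L × Fin 3 × Fin 4 => (χ k.1 : ℂ)) * H)) i j‖ =
      ‖(H *ᵥ fun k => (χ k.1 : ℂ) * conj (K i k)) j -
        (χ j.1 : ℂ) * (H *ᵥ fun k => conj (K i k)) j‖ := by
  rw [Matrix.mul_apply]
  simp only [Matrix.sub_apply, Matrix.mul_diagonal, Matrix.diagonal_mul, Matrix.mulVec, dotProduct]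
  rw [Finset.mul_sum, ← Finset.sum_sub_distrib, ← RCLike.norm_conj, map_sum, ← norm_neg,
    ← Finset.sum_neg_distrib]
  congr 1
  refine Finset.sum_congr rfl fun k _ => ?_
  have hjk : conj (H k j) = H j k := hH.apply j k
  rw [map_mul, map_sub, map_mul, map_mul, Complex.conj_ofReal, Complex.conj_ofReal, hjk]
  ring

/-- **Support.**  Since `H₁` couples only sites at torus distance `≤ 2` and `χ` is constant (`1`,
resp. `0`) on the ball of radius `N` (resp. off the ball of radius `2N`) about `x`, the entry
vanishes unless `N - 2 ≤ torusDist x j ≤ 2N + 2`. -/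
theorem comm_entry_eq_zero
    (K : Matrix (TorusSite 4 L × Fin 3 × Fin 4) (TorusSite 4 L × Fin 3 × Fin 4) ℂ)
    (m : ℝ) (χ : TorusSite 4 L → ℝ) (x : TorusSite 4 L) (N : ℕ)
    (hχ1 : ∀ z, torusDist x z ≤ N → χ z = 1) (hχ0 : ∀ z, 2 * N ≤ torusDist x z → χ z = 0)
    (i j : TorusSite 4 L × Fin 3 × Fin 4)
    (hj : torusDist x j.1 + 3 ≤ N ∨ 2 * N + 3 ≤ torusDist x j.1) :
    (K * (((wilsonDirac (fundamentalRep (Fin 3)) (freeCfg L) m 1)ᴴ *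
          wilsonDirac (fundamentalRep (Fin 3)) (freeCfg L) m 1) *
        Matrix.diagonal (fun k : TorusSite 4 L × Fin 3 × Fin 4 => (χ k.1 : ℂ)) -
        Matrix.diagonal (fun k : TorusSite 4 L × Fin 3 × Fin 4 => (χ k.1 : ℂ)) *
        ((wilsonDirac (fundamentalRep (Fin 3)) (freeCfg L) m 1)ᴴ *
          wilsonDirac (fundamentalRep (Fin 3)) (freeCfg L) m 1))) i j = 0 := by
  rw [Matrix.mul_apply]
  refine Finset.sum_eq_zero fun k _ => ?_
  simp only [Matrix.sub_apply, Matrix.mul_diagonal, Matrix.diagonal_mul]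
  by_cases hk : 2 < torusDist k.1 j.1
  · rw [conjTranspose_mul_wilsonDirac_apply_eq_zero _ _ _ _ k j hk]; ring
  · have hk' := not_lt.mp hk
    have t1 := torusDist_triangle' x j.1 k.1
    have t2 := torusDist_triangle' x k.1 j.1
    rw [torusDist_comm' j.1 k.1] at t1
    have hkj : χ k.1 = χ j.1 := by
      rcases hj with hj | hj
      · rw [hχ1 _ (by omega), hχ1 _ (by omega)]
      · rw [hχ0 _ (by omega), hχ0 _ (by omega)]
    rw [hkj]; ring

/-- **Counting**: at most `12 (2R + 1)⁴` indices `j` have `torusDist x j.1 ≤ R`. -/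
theorem card_ball_le (x : TorusSite 4 L) (R : ℕ) :
    (Finset.univ.filter fun j : TorusSite 4 L × Fin 3 × Fin 4 => torusDist x j.1 ≤ R).card ≤
      12 * (2 * R + 1) ^ 4 := by
  classical
  set B : Finset (ZMod L) := Finset.univ.filter fun z : ZMod L => min z.val (L - z.val) ≤ R with hB
  have hBc : B.card ≤ 2 * R + 1 := card_filter_cyclicAbs_le_le R
  calc _ ≤ ((Fintype.piFinset fun _ : Fin 4 => B) ×ˢ
          (Finset.univ : Finset (Fin 3 × Fin 4))).card := by
        refine Finset.card_le_card_of_injOn (fun j => (j.1 - x, j.2)) (fun j hj => ?_) ?_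
        · simp only [Finset.coe_filter, Finset.mem_univ, true_and, Set.mem_setOf_eq] at hj
          simp only [Finset.coe_product, Finset.coe_univ, Set.mem_prod, Set.mem_univ, and_true,
            Finset.mem_coe, Fintype.mem_piFinset, hB, Finset.mem_filter, Finset.mem_univ, true_and]
          intro ν
          refine le_trans ?_ hj
          rw [torusDist_comm']
          exact Finset.le_sup (f := fun i => min ((j.1 - x) i).val (L - ((j.1 - x) i).val))
            (Finset.mem_univ ν)
        · intro j _ j' _ h
          simp only [Prod.mk.injEq, sub_left_inj] at h
          exact Prod.ext h.1 h.2
    _ = B.card ^ 4 * 12 := by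
        rw [Finset.card_product, Fintype.card_piFinset, Finset.prod_const, Finset.card_univ,
          Fintype.card_fin, Finset.card_univ, Fintype.card_prod, Fintype.card_fin, Fintype.card_fin]
    _ ≤ (2 * R + 1) ^ 4 * 12 := by gcongr
    _ = _ := by ring

/-- **Row bound** (abstract form): given the cutoff facts (`χ = 1`/`0` regions, first and second
differences `≤ A₁`, `A₂`) and bounds `B₀`, `B₁` for the row `K(i, ·)` and its unit-step differences
at distance `≥ N - 4` from `x`, the squared `ℓ²` norm of the row of `K [H₁, M_χ]` is at most
`12 (4N + 5)⁴ (2056 (A₂B₀ + A₁B₁))²`. -/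
theorem row_sq_sum_le {m : ℝ} (hm : |m| ≤ 1) {N : ℕ} (x : TorusSite 4 L)
    (χ : TorusSite 4 L → ℝ) {A₁ A₂ : ℝ}
    (hχ1 : ∀ z, torusDist x z ≤ N → χ z = 1) (hχ0 : ∀ z, 2 * N ≤ torusDist x z → χ z = 0)
    (hA₁ : ∀ y μ (σ : ZMod L), (σ = 1 ∨ σ = -1) → |χ (y + Pi.single μ σ) - χ y| ≤ A₁)
    (hA₂ : ∀ y μ ν (σ τ : ZMod L), (σ = 1 ∨ σ = -1) → (τ = 1 ∨ τ = -1) →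
      |χ (y + Pi.single μ σ + Pi.single ν τ) - χ (y + Pi.single μ σ) - χ (y + Pi.single ν τ) + χ y|
        ≤ A₂)
    (K : Matrix (TorusSite 4 L × Fin 3 × Fin 4) (TorusSite 4 L × Fin 3 × Fin 4) ℂ) (a : Fin 3)
    (α : Fin 4) {B₀ B₁ : ℝ}
    (hK0 : ∀ y b β, N ≤ torusDist x y + 4 → ‖K (x, a, α) (y, b, β)‖ ≤ B₀)
    (hK1 : ∀ y b β μ, N ≤ torusDist x y + 4 →
      ‖K (x, a, α) (y, b, β) - K (x, a, α) (y + Pi.single μ 1, b, β)‖ ≤ B₁) :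
    ∑ j, ‖(K * (((wilsonDirac (fundamentalRep (Fin 3)) (freeCfg L) m 1)ᴴ *
          wilsonDirac (fundamentalRep (Fin 3)) (freeCfg L) m 1) *
        Matrix.diagonal (fun k : TorusSite 4 L × Fin 3 × Fin 4 => (χ k.1 : ℂ)) -
        Matrix.diagonal (fun k : TorusSite 4 L × Fin 3 × Fin 4 => (χ k.1 : ℂ)) *
        ((wilsonDirac (fundamentalRep (Fin 3)) (freeCfg L) m 1)ᴴ *
          wilsonDirac (fundamentalRep (Fin 3)) (freeCfg L) m 1))) (x, a, α) j‖ ^ 2 ≤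
      12 * (4 * (N : ℝ) + 5) ^ 4 * (2056 * (A₂ * B₀ + A₁ * B₁)) ^ 2 := by
  set V := 2056 * (A₂ * B₀ + A₁ * B₁) with hV
  have hHerm := Matrix.isHermitian_conjTranspose_mul_self
    (wilsonDirac (fundamentalRep (Fin 3)) (freeCfg L) m 1)
  have key : ∀ j : TorusSite 4 L × Fin 3 × Fin 4,
      ‖(K * (((wilsonDirac (fundamentalRep (Fin 3)) (freeCfg L) m 1)ᴴ *
          wilsonDirac (fundamentalRep (Fin 3)) (freeCfg L) m 1) *
        Matrix.diagonal (fun k : TorusSite 4 L × Fin 3 × Fin 4 => (χ k.1 : ℂ)) -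
        Matrix.diagonal (fun k : TorusSite 4 L × Fin 3 × Fin 4 => (χ k.1 : ℂ)) *
        ((wilsonDirac (fundamentalRep (Fin 3)) (freeCfg L) m 1)ᴴ *
          wilsonDirac (fundamentalRep (Fin 3)) (freeCfg L) m 1))) (x, a, α) j‖ ^ 2 ≤
      if torusDist x j.1 ≤ 2 * N + 2 then V ^ 2 else 0 := by
    rintro ⟨z, b, β⟩
    dsimp only
    split_ifs with hz
    · by_cases hz' : torusDist x z + 3 ≤ N
      · rw [comm_entry_eq_zero K m χ x N hχ1 hχ0 _ _ (Or.inl hz'), norm_zero,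
          zero_pow two_ne_zero]
        positivity
      · rw [comm_entry_norm K _ hHerm χ]
        refine pow_le_pow_left₀ (norm_nonneg _) ?_ 2
        refine stub_commutatorBoundLocal L m hm χ A₁ A₂ hA₁ hA₂ _ z B₀ B₁ (fun y hy b' β' => ?_)
          (fun y hy b' β' μ σ hσ => ?_) b β
        · rw [RCLike.norm_conj]
          have t := torusDist_triangle' x y z
          rw [torusDist_comm' y z] at t
          exact hK0 y b' β' (by omega)
        · have t := torusDist_triangle' x y z
          rw [torusDist_comm' y z] at t
          rw [← map_sub, RCLike.norm_conj, norm_sub_rev]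
          rcases hσ with rfl | rfl
          · exact hK1 y b' β' μ (by omega)
          · have e : y + Pi.single μ (-1) + Pi.single μ 1 = y := by
              rw [Pi.single_neg, neg_add_cancel_right]
            have t' := torusDist_triangle' x (y + Pi.single μ (-1)) y
            have t'' : torusDist (y + Pi.single μ (-1)) y ≤ 1 := by
              have h := torusDist_self_shift_le (y + Pi.single μ (-1 : ZMod L)) μ
              rwa [Site.shift, e] at h
            rw [norm_sub_rev]
            nth_rw 2 [← e]
            exact hK1 (y + Pi.single μ (-1)) b' β' μ (by omega)
    · have hz2 := not_le.mp hz
      rw [comm_entry_eq_zero K m χ x N hχ1 hχ0 _ _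
        (Or.inr (show 2 * N + 3 ≤ torusDist x z by omega)), norm_zero, zero_pow two_ne_zero]
  calc _ ≤ ∑ j : TorusSite 4 L × Fin 3 × Fin 4,
          (if torusDist x j.1 ≤ 2 * N + 2 then V ^ 2 else 0) :=
        Finset.sum_le_sum fun j _ => key j
    _ = (Finset.univ.filter fun j : TorusSite 4 L × Fin 3 × Fin 4 =>
          torusDist x j.1 ≤ 2 * N + 2).card * V ^ 2 := by
        rw [← Finset.sum_filter, Finset.sum_const, nsmul_eq_mul]
    _ ≤ (12 * (2 * (2 * N + 2) + 1) ^ 4 : ℕ) * V ^ 2 := by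
        gcongr; exact card_ball_le x (2 * N + 2)
    _ = _ := by push_cast; ring

end RowSum

end CommutatorBound

open CommutatorBound in
/-- **Stub `stub_commutatorBound`** (line `point-centred-axial-parabolic`).  If the free massive
heat kernel `K_σ = e^{-σH₁}` has the parabolic decay `|K_σ(i,j)| ≤ C e^{-cσm²}(1+σ)/(1+σ+d²)³` and
nearest-neighbour column differences `≤ C e^{-cσm²}√(1+σ)/(1+σ+d²)³` (`d = torusDist`), then the
row at `i = (x,a,α)` of `K_σ [H₁, M_χ]`, `M_χ` the product cutoff of scale `N ≥ 8` centred at `x`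
(`4N + 8 ≤ L`), has squared `ℓ²` norm `≤ (C'/N⁴)²`, uniformly in `σ ∈ [0, L²]` and
`m ∈ [-1/2, 1]`: the entry at `j` is (up to conjugation) `[H₁, χ]` applied to the row and vanishes
unless `N - 2 ≤ torusDist x j ≤ 2N + 2` (`≤ 12 (4N+5)⁴` indices), where the row is `O(N⁻⁴)` with
differences `O(N⁻⁵)` while `∇χ = O(N⁻¹)`, `∇²χ = O(N⁻²)`, so each entry is `O(N⁻⁶)`. -/
theorem stub_commutatorBound :
    (∃ C c : ℝ, 0 < c ∧ ∀ (L : ℕ) [NeZero L] (m : ℝ), m ∈ Set.Icc (-(1 / 2 : ℝ)) 1 →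
      ∀ σ : ℝ, 0 ≤ σ → σ ≤ (L : ℝ) ^ 2 →
      ∀ (x z : TorusSite 4 L) (a b : Fin 3) (α β : Fin 4),
        ‖(NormedSpace.exp (-(σ : ℂ) •
            ((wilsonDirac (fundamentalRep (Fin 3)) (freeCfg L) m 1)ᴴ *
              wilsonDirac (fundamentalRep (Fin 3)) (freeCfg L) m 1))) (x, a, α) (z, b, β)‖
          ≤ C * Real.exp (-(c * σ * m ^ 2)) * (1 + σ) / (1 + σ + (torusDist x z : ℝ) ^ 2) ^ 3 ∧
        ∀ μ : Fin 4,
          ‖(NormedSpace.exp (-(σ : ℂ) •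
              ((wilsonDirac (fundamentalRep (Fin 3)) (freeCfg L) m 1)ᴴ *
                wilsonDirac (fundamentalRep (Fin 3)) (freeCfg L) m 1))) (x, a, α) (z, b, β) -
            (NormedSpace.exp (-(σ : ℂ) •
              ((wilsonDirac (fundamentalRep (Fin 3)) (freeCfg L) m 1)ᴴ *
                wilsonDirac (fundamentalRep (Fin 3)) (freeCfg L) m 1))) (x, a, α) (Site.shift z μ, b, β)‖
          ≤ C * Real.exp (-(c * σ * m ^ 2)) * Real.sqrt (1 + σ) / (1 + σ + (torusDist x z : ℝ) ^ 2) ^ 3) →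
    (∃ C : ℝ, ∀ (L : ℕ) [NeZero L] (m : ℝ), m ∈ Set.Icc (-(1 / 2 : ℝ)) 1 →
      ∀ σ : ℝ, 0 ≤ σ → σ ≤ (L : ℝ) ^ 2 → ∀ (x : TorusSite 4 L) (a : Fin 3) (α : Fin 4) (N : ℕ),
        8 ≤ N → 4 * N + 8 ≤ L →
        ∑ j, ‖(NormedSpace.exp (-(σ : ℂ) •
              ((wilsonDirac (fundamentalRep (Fin 3)) (freeCfg L) m 1)ᴴ *
                wilsonDirac (fundamentalRep (Fin 3)) (freeCfg L) m 1)) *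
            (((wilsonDirac (fundamentalRep (Fin 3)) (freeCfg L) m 1)ᴴ *
                wilsonDirac (fundamentalRep (Fin 3)) (freeCfg L) m 1) *
              Matrix.diagonal (fun j : TorusSite 4 L × Fin 3 × Fin 4 => (((∏ ν : Fin 4, (max 0 (1 - (max 0 ((min ((j.1 - x) ν).val (L - ((j.1 - x) ν).val) : ℝ) / (N : ℝ) - 1)) ^ 2)) ^ 2) : ℝ) : ℂ)) -
             Matrix.diagonal (fun j : TorusSite 4 L × Fin 3 × Fin 4 => (((∏ ν : Fin 4, (max 0 (1 - (max 0 ((min ((j.1 - x) ν).val (L - ((j.1 - x) ν).val) : ℝ) / (N : ℝ) - 1)) ^ 2)) ^ 2) : ℝ) : ℂ)) *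
              ((wilsonDirac (fundamentalRep (Fin 3)) (freeCfg L) m 1)ᴴ *
                wilsonDirac (fundamentalRep (Fin 3)) (freeCfg L) m 1))) (x, a, α) j‖ ^ 2 ≤
          (C / (N : ℝ) ^ 4) ^ 2) := by
  rintro ⟨C₀, c, hc, hK⟩
  refine ⟨100 * 2056 * 1408 * |C₀|, fun L _ m hm σ hσ hσL x a α N hN hNL => ?_⟩
  obtain ⟨hχ1, hχ0, hA₁, hA₂⟩ := stub_commutatorBoundAux L N (by omega) (by omega) x
    (fun z => ∏ ν : Fin 4, (max 0 (1 - (max 0 ((min ((z - x) ν).val (L - ((z - x) ν).val) : ℝ) /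
      (N : ℝ) - 1)) ^ 2)) ^ 2) (fun z => rfl)
  have hm1 : |m| ≤ 1 := abs_le.2 ⟨by linarith [hm.1], hm.2⟩
  have hN8 : (8 : ℝ) ≤ N := by exact_mod_cast hN
  have hNpos : (0 : ℝ) < N := by linarith
  -- the two kernel bounds at distance `d ≥ N - 4 ≥ N/2` from `x`
  have hgeom : ∀ y : TorusSite 4 L, N ≤ torusDist x y + 4 →
      (1 + σ) / (1 + σ + (torusDist x y : ℝ) ^ 2) ^ 3 ≤ 16 / (N : ℝ) ^ 4 ∧
      Real.sqrt (1 + σ) / (1 + σ + (torusDist x y : ℝ) ^ 2) ^ 3 ≤ 32 / (N : ℝ) ^ 5 := by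
    intro y hy
    set d : ℝ := (torusDist x y : ℝ) with hd
    have hNd : (N : ℝ) ≤ 2 * d := by
      have : (N : ℝ) ≤ (torusDist x y : ℝ) + 4 := by exact_mod_cast hy
      linarith
    have hd0 : 0 ≤ d := by positivity
    set P : ℝ := 1 + σ + d ^ 2 with hP
    have hP0 : 0 < P := by positivity
    have h3 : 1 + σ ≤ P := by rw [hP]; nlinarith
    have h1 : (N : ℝ) ^ 2 ≤ 4 * P := by
      have h := pow_le_pow_left₀ hNpos.le hNd 2
      rw [hP]; nlinarith
    have h2 : (N : ℝ) ^ 4 ≤ 16 * P ^ 2 := by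
      calc (N : ℝ) ^ 4 = ((N : ℝ) ^ 2) ^ 2 := by ring
        _ ≤ (4 * P) ^ 2 := pow_le_pow_left₀ (by positivity) h1 2
        _ = 16 * P ^ 2 := by ring
    constructor
    · rw [div_le_div_iff₀ (by positivity) (by positivity)]
      calc (1 + σ) * (N : ℝ) ^ 4 ≤ P * (16 * P ^ 2) := mul_le_mul h3 h2 (by positivity) hP0.le
        _ = 16 * P ^ 3 := by ring
    · rw [div_le_div_iff₀ (by positivity) (by positivity)]
      have hs : Real.sqrt (1 + σ) ≤ Real.sqrt P := Real.sqrt_le_sqrt h3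
      have hdP : d ≤ Real.sqrt P := by
        rw [← Real.sqrt_sq hd0]; exact Real.sqrt_le_sqrt (by rw [hP]; nlinarith)
      calc Real.sqrt (1 + σ) * (N : ℝ) ^ 5 = Real.sqrt (1 + σ) * N * (N : ℝ) ^ 4 := by ring
        _ ≤ Real.sqrt P * (2 * Real.sqrt P) * (16 * P ^ 2) := by
            refine mul_le_mul (mul_le_mul hs (hNd.trans (by linarith)) hNpos.le
              (Real.sqrt_nonneg _))
              h2 (by positivity) (by positivity)
        _ = 32 * P ^ 3 := by
            rw [show Real.sqrt P * (2 * Real.sqrt P) = 2 * (Real.sqrt P * Real.sqrt P) by ring,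
              Real.mul_self_sqrt hP0.le]; ring
  have hE : Real.exp (-(c * σ * m ^ 2)) ≤ 1 := by
    rw [Real.exp_le_one_iff, neg_nonpos]; positivity
  have hK0 : ∀ (y : TorusSite 4 L) (b : Fin 3) (β : Fin 4), N ≤ torusDist x y + 4 →
      ‖(NormedSpace.exp (-(σ : ℂ) • ((wilsonDirac (fundamentalRep (Fin 3)) (freeCfg L) m 1)ᴴ *
        wilsonDirac (fundamentalRep (Fin 3)) (freeCfg L) m 1))) (x, a, α) (y, b, β)‖ ≤
        16 * |C₀| / (N : ℝ) ^ 4 := by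
    intro y b β hy
    refine ((hK L m hm σ hσ hσL x y a b α β).1).trans ?_
    have hg := (hgeom y hy).1
    have hpos : 0 ≤ (1 + σ) / (1 + σ + (torusDist x y : ℝ) ^ 2) ^ 3 := by positivity
    calc C₀ * Real.exp (-(c * σ * m ^ 2)) * (1 + σ) / (1 + σ + (torusDist x y : ℝ) ^ 2) ^ 3
        = C₀ * Real.exp (-(c * σ * m ^ 2)) * ((1 + σ) / (1 + σ + (torusDist x y : ℝ) ^ 2) ^ 3) := by
          ring
      _ ≤ |C₀| * 1 * (16 / (N : ℝ) ^ 4) := by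
          refine mul_le_mul (mul_le_mul (le_abs_self _) hE (by positivity) (abs_nonneg _)) hg hpos
            (by positivity)
      _ = _ := by ring
  have hK1 : ∀ (y : TorusSite 4 L) (b : Fin 3) (β : Fin 4) (μ : Fin 4), N ≤ torusDist x y + 4 →
      ‖(NormedSpace.exp (-(σ : ℂ) • ((wilsonDirac (fundamentalRep (Fin 3)) (freeCfg L) m 1)ᴴ *
        wilsonDirac (fundamentalRep (Fin 3)) (freeCfg L) m 1))) (x, a, α) (y, b, β) -
       (NormedSpace.exp (-(σ : ℂ) • ((wilsonDirac (fundamentalRep (Fin 3)) (freeCfg L) m 1)ᴴ *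
        wilsonDirac (fundamentalRep (Fin 3)) (freeCfg L) m 1))) (x, a, α)
          (y + Pi.single μ 1, b, β)‖ ≤
        32 * |C₀| / (N : ℝ) ^ 5 := by
    intro y b β μ hy
    refine ((hK L m hm σ hσ hσL x y a b α β).2 μ).trans ?_
    have hg := (hgeom y hy).2
    have hpos : 0 ≤ Real.sqrt (1 + σ) / (1 + σ + (torusDist x y : ℝ) ^ 2) ^ 3 := by positivity
    calc C₀ * Real.exp (-(c * σ * m ^ 2)) * Real.sqrt (1 + σ) /
          (1 + σ + (torusDist x y : ℝ) ^ 2) ^ 3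
        = C₀ * Real.exp (-(c * σ * m ^ 2)) *
            (Real.sqrt (1 + σ) / (1 + σ + (torusDist x y : ℝ) ^ 2) ^ 3) := by ring
      _ ≤ |C₀| * 1 * (32 / (N : ℝ) ^ 5) := by
          refine mul_le_mul (mul_le_mul (le_abs_self _) hE (by positivity) (abs_nonneg _)) hg hpos
            (by positivity)
      _ = _ := by ring
  refine (row_sq_sum_le hm1 x _ hχ1 hχ0 hA₁ hA₂ _ a α hK0 hK1).trans ?_
  have h45 : (4 * (N : ℝ) + 5) ^ 4 ≤ 625 * (N : ℝ) ^ 4 := by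
    calc (4 * (N : ℝ) + 5) ^ 4 ≤ (5 * (N : ℝ)) ^ 4 :=
          pow_le_pow_left₀ (by positivity) (by linarith) 4
      _ = 625 * (N : ℝ) ^ 4 := by ring
  have ha : (72 : ℝ) / (N : ℝ) ^ 2 * (16 * |C₀| / (N : ℝ) ^ 4) +
      8 / (N : ℝ) * (32 * |C₀| / (N : ℝ) ^ 5) =
      1408 * |C₀| / (N : ℝ) ^ 6 := by
    rw [div_mul_div_comm, div_mul_div_comm, div_add_div _ _ (by positivity) (by positivity),
      div_eq_div_iff (by positivity) (by positivity)]
    ring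
  rw [ha]
  set X : ℝ := 2056 * 1408 * |C₀| with hX
  calc 12 * (4 * (N : ℝ) + 5) ^ 4 * (2056 * (1408 * |C₀| / (N : ℝ) ^ 6)) ^ 2
      = 12 * (4 * (N : ℝ) + 5) ^ 4 * (X ^ 2 / (N : ℝ) ^ 12) := by rw [hX]; ring
    _ ≤ 7500 * (N : ℝ) ^ 4 * (X ^ 2 / (N : ℝ) ^ 12) :=
        mul_le_mul_of_nonneg_right (by linarith [h45]) (by positivity)
    _ = 7500 * ((N : ℝ) ^ 4 * X ^ 2 / ((N : ℝ) ^ 4 * (N : ℝ) ^ 8)) := by ring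
    _ = 7500 * (X ^ 2 / (N : ℝ) ^ 8) := by rw [mul_div_mul_left _ _ (by positivity)]
    _ ≤ 10000 * (X ^ 2 / (N : ℝ) ^ 8) := by gcongr; norm_num
    _ = (100 * 2056 * 1408 * |C₀| / (N : ℝ) ^ 4) ^ 2 := by rw [hX]; ring

end Summit.QuantumFields.QCD.Cruxes.SmallFieldUltracontractivity.PointCentredAxialParabolic

end
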